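/-
Origin: expansion seat `planner-pub-hodgecm-pv14-g3-0`, handover #6 2026-08-18T05:53:44Z (`HOME/pub-hodgecm-pv14-g3/lean/Pv14g3/PerL34/P43KTypesSmoke.lean`, md5 4dd738b1, 65 lines);
landed by the gen-6 packager in gate run 24 as `HodgeCM/PerL34/P43_KTypesSmoke.lean` (import ^import Pv14g3\.PerL34\.P43KTypesFockJplus\b→import HodgeCM.PerL34.P43_KTypesFockJplus ×1).
-/
/-
Origin: HOME/pub-hodgecm-pv14-g3/lean/Pv14g3/PerL34/P43KTypesSmoke.lean — session planner-pub-hodgecm-pv14-g3-0 (unit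
pub-hodgecm-pv14-g3, DAG-NODE PROVER #14 gen 3).  Intended final place: `HodgeCM/PerL34/P43_KTypesSmoke.lean`, after
`P43_KTypesFockJplus.lean` (this seat, run 23).  On landing rewrite the import
`Pv14g3.PerL34.P43KTypesFockJplus` ↦ `HodgeCM.PerL34.P43_KTypesFockJplus`.  Nothing cited, nothing asserted.
-/
import Summits.HodgeConjecture.HodgeCM.PerL34.P43_KTypesFockJplus

set_option autoImplicit false

/-!
# N33b (X1), concrete `K_{ι₁}`-types VI: NON-VACUITY smoke tests for the kernel leaves

Referee question "are the hypotheses `hQ`, `h₀ h₁` of `thetaPKilledByPminus_of_U2(_fock|_Jplus)` satisfiable, and do the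
exclusion statements discriminate?" — answered by instances inside the model:

* `generatedBy_pPlus_self` : `Q := 𝔭₊` itself is `𝔭₊`-isotypic (`hQ` holds), hence by `hgen_of_pPlusIsotypic` the
  abstract `hgen` leaf holds for `P = 𝔭₋ ⊗ 𝔭₊` (`hgen_pMinus_tprod_pPlus` — this is [BW] VI 4.9 for `n = 2`, kernel);
* `noEmbedding_Jplus_self` : `N := J⁺|_K` (one copy, `ι = Unit`) contains neither `F_{0,0}` nor `F_{1,1}` (`h₀ h₁` hold
  for the model itself);
* `not_noEmbedding_pPlus_Jplus` : but `𝔭₊` DOES embed into `J⁺|_K` (`zEmb`), so `NoEmbedding` is not vacuously true on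
  `J⁺` — the exclusions are genuine `K`-type statements.
-/

noncomputable section

namespace HodgeCM
namespace PerL34
namespace P43KTypesU2

open P43KTypes P43X1Bridge

/-- `Q := 𝔭₊` is `𝔭₊`-isotypic: `hQ` of `thetaPKilledByPminus_of_U2` holds for the smallest model. -/
theorem generatedBy_pPlus_self : generatedBy (MonoidAlgebra ℂ K) pPlus.asModule pPlus.asModule = ⊤ := by
  rw [eq_top_iff]
  intro v _
  exact le_iSup (fun f : pPlus.asModule →ₗ[MonoidAlgebra ℂ K] pPlus.asModule => LinearMap.range f) LinearMap.id
    (LinearMap.mem_range.mpr ⟨v, rfl⟩)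

/-- [BW] VI 4.9 for `n = 2`, as the `hgen` leaf of the X1 bridge with `Q = 𝔭₊`:
`𝔭₋ ⊗ 𝔭₊` is the sum of its `F_{0,0}`- and `F_{1,1}`-generated parts. -/
theorem hgen_pMinus_tprod_pPlus :
    generatedBy (MonoidAlgebra ℂ K) F00.asModule (pMinus.tprod pPlus).asModule ⊔
      generatedBy (MonoidAlgebra ℂ K) F11.asModule (pMinus.tprod pPlus).asModule = ⊤ :=
  hgen_of_pPlusIsotypic pPlus generatedBy_pPlus_self

/-- `h₀ h₁` hold for `N := J⁺|_K` itself: the `J⁺`-piece of the Fock model contains no `F_{0,0}` and no `F_{1,1}`. -/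
theorem noEmbedding_Jplus_self :
    NoEmbedding (MonoidAlgebra ℂ K) F00.asModule Jplus.asModule ∧
      NoEmbedding (MonoidAlgebra ℂ K) F11.asModule Jplus.asModule :=
  noEmbedding_of_Jplus (ι := Unit) (LinearMap.pi fun _ => LinearMap.id) (fun _ _ h => congrFun h ())

/-- … whereas `𝔭₊` DOES occur in `J⁺|_K` (as `span{z₁, z₂}`, `zEmb`): the notion `NoEmbedding` discriminates. -/
theorem not_noEmbedding_pPlus_Jplus : ¬ NoEmbedding (MonoidAlgebra ℂ K) pPlus.asModule Jplus.asModule := fun h =>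
  h (Representation.IntertwiningMap.equivLinearMapAsModule pPlus Jplus zEmb) (fun _ _ hxy => zEmb_injective hxy)

/-- `F_{1,1}` also fails to embed into the WHOLE Fock model (not just `J⁺`), one copy. -/
theorem noEmbedding_F11_fock_self : NoEmbedding (MonoidAlgebra ℂ K) F11.asModule fockRep.asModule :=
  noEmbedding_F11_of_fock (ι := Unit) (LinearMap.pi fun _ => LinearMap.id) (fun _ _ h => congrFun h ())

end P43KTypesU2
end PerL34
end HodgeCM

end
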